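import Literature.AnabelianGeometry.EtaleTheta.Discharge.Sec2RigidityProofs
import Literature.AnabelianGeometry.EtaleTheta.Discharge.Sec2IsoLift

/-!
# Automorphisms of `Π^tp_Y[μ_N]` over an automorphism of `Π^tp_Y` (tools for [EtTh] Cor 2.18 (iv))

Mochizuki, *The Étale Theta Function …* [EtTh], Publ. RIMS 45 (2009), §2, Def 2.13, Cor 2.18 (iv),
PRIMS text pp.47, 61–63 (locators `p.N` = PDF pages; bib key `MochizukiEtTh2009`).

PROOF-ONLY companion (no `def`) of `MonoThetaEnv.lean` / `ThetaRigidity.lean` (seat abc-iut-L2-t2),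
unit W2-L2-06 / Cor 2.18 (abc-iut-L2-t10). General bookkeeping used by the reduction of
Cor 2.18 (iv), surjectivity (`Sec2LiftingSurjProofs.lean`):

* `CycEnvelope.image_muConjClass_eq_of_perm` — an automorphism PERMUTING the cyclotome carries
  `μ_N`-conjugacy classes to `μ_N`-conjugacy classes (generalises `image_muConjClass_eq`);
* `ThetaEnvData.exists_modelIso_of_aut'` — Def 2.13 (ii) iso constructor for automorphisms
  permuting (not necessarily fixing) `μ_N`;
* `ThetaEnvData.DY_map_conj_eq_of_generators` — `[c]` normalises `D_Y` as soon as it conjugates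
  the generators of `D_Y` into `D_Y` in both directions;
* `ThetaEnvData.conj_shift_of_shape`, `conj_conjX_of_shape`, `DY_conj_gen_of_shape` — an
  automorphism of SHAPE `(a, g) ↦ (ψ a, γ g)` (`ψ ∈ Aut μ_N` commuting with the cyclotomic
  character, `γ ∈ Aut Π^tp_X` preserving `Π^tp_Y`, the fibres of the augmentation and the
  cyclotomic character) conjugates Kummer shifts to Kummer shifts and `conj_x` to `conj_{γ x}`,
  hence conjugates the generators of `D_Y` into `D_Y`.
-/

namespace Literature.AnabelianGeometry.EtaleTheta

universe u

namespace CycEnvelope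

variable {P G μ : Type*} [Group P] [Group G] [CommGroup μ] (aug : P →* G) (χ : G →* MulAut μ)

/-- An automorphism of `Π[μ_N]` mapping the cyclotome `μ_N` ONTO itself carries the `μ_N`-conjugacy
class of `H` onto the `μ_N`-conjugacy class of the image of `H`.
[cite: MochizukiEtTh2009, Def 2.10 p.44] -/
theorem image_muConjClass_eq_of_perm (α : MulAut (CycEnvelope aug χ))
    (hα : ∀ a : μ, ∃ b : μ, α (inMu aug χ a) = inMu aug χ b)
    (hα' : ∀ b : μ, ∃ a : μ, α (inMu aug χ a) = inMu aug χ b) (H : Subgroup (CycEnvelope aug χ)) :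
    (fun K : Subgroup (CycEnvelope aug χ) => K.map α.toMonoidHom) '' muConjClass aug χ H =
      muConjClass aug χ (H.map α.toMonoidHom) := by
  have key : ∀ a b : μ, α (inMu aug χ a) = inMu aug χ b →
      (α.toMonoidHom).comp (MulAut.conj (inMu aug χ a)).toMonoidHom =
        (MulAut.conj (inMu aug χ b)).toMonoidHom.comp α.toMonoidHom := by
    intro a b hab
    refine MonoidHom.ext fun x => ?_
    simp only [MonoidHom.coe_comp, Function.comp_apply, MulEquiv.coe_toMonoidHom, MulAut.conj_apply,
      map_mul, map_inv, hab]
  ext K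
  constructor
  · rintro ⟨_, ⟨a, rfl⟩, rfl⟩
    obtain ⟨b, hb⟩ := hα a
    refine ⟨b, ?_⟩
    change (H.map _).map _ = (H.map _).map _
    rw [Subgroup.map_map, Subgroup.map_map, key a b hb]
  · rintro ⟨b, rfl⟩
    obtain ⟨a, ha⟩ := hα' b
    refine ⟨H.map (MulAut.conj (inMu aug χ a)).toMonoidHom, ⟨a, rfl⟩, ?_⟩
    change (H.map _).map _ = (H.map _).map _
    rw [Subgroup.map_map, Subgroup.map_map, key a b ha]

end CycEnvelope

namespace ThetaEnvData

variable {N : ℕ+} (T : ThetaEnvData.{u} N)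

/-- **Def 2.13 (ii) iso constructor, permutation version**: a bi-continuous automorphism `c` of
`Π^tp_Y[μ_N]` whose class normalises `D_Y`, which maps `μ_N` onto itself and carries `Im(s^Θ_η)`
onto `Im(s^Θ_{η'})`, underlies an isomorphism `M(η) ≃ M(η')`.
[cite: MochizukiEtTh2009, Def 2.13(ii) p.47] -/
theorem exists_modelIso_of_aut' {η η' : T.PiYdd → T.mu} (hη : η ∈ T.thetaCocycles)
    (hη' : η' ∈ T.thetaCocycles) (c : contMulAut T.env)
    (hD : T.DY.map (MulAut.conj (TopOut.mk _ c)).toMonoidHom = T.DY)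
    (hμ : ∀ a, ∃ b, (c : MulAut T.env) (CycEnvelope.inMu T.augY T.chi a) =
      CycEnvelope.inMu T.augY T.chi b)
    (hμ' : ∀ b, ∃ a, (c : MulAut T.env) (CycEnvelope.inMu T.augY T.chi a) =
      CycEnvelope.inMu T.augY T.chi b)
    (hs : (T.sTheta hη).range.map (c : MulAut T.env).toMonoidHom = (T.sTheta hη').range) :
    ∃ α : (T.modelMono hη).Iso (T.modelMono hη'), ∀ x, α.e x = (c : MulAut T.env) x := by
  refine ⟨{ e := ContinuousMulEquiv.mk (c : MulAut T.env) c.2.1 c.2.2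
            map_D := ?_
            map_sTheta := ?_ }, fun x => rfl⟩
  · change T.DY.map _ = T.DY
    rw [TopOut.transport_mk_eq_conj]
    exact hD
  · change (fun H : Subgroup T.env => H.map (c : MulAut T.env).toMonoidHom) ''
        CycEnvelope.muConjClass T.augY T.chi (T.sTheta hη).range =
      CycEnvelope.muConjClass T.augY T.chi (T.sTheta hη').range
    rw [CycEnvelope.image_muConjClass_eq_of_perm T.augY T.chi _ hμ hμ', hs]

/-- `[c]` normalises `D_Y` as soon as `[c]` and `[c]⁻¹` conjugate every generator of `D_Y` into
`D_Y`. [cite: MochizukiEtTh2009, Def 2.13(i) p.47] -/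
theorem DY_map_conj_eq_of_generators (c : contMulAut T.env)
    (h1 : ∀ d ∈ T.kummerOut ∪ T.galOut, TopOut.mk _ c * d * (TopOut.mk _ c)⁻¹ ∈ T.DY)
    (h2 : ∀ d ∈ T.kummerOut ∪ T.galOut, (TopOut.mk _ c)⁻¹ * d * TopOut.mk _ c ∈ T.DY) :
    T.DY.map (MulAut.conj (TopOut.mk _ c)).toMonoidHom = T.DY := by
  have hinv : T.DY.map (MulAut.conj (TopOut.mk _ c)⁻¹).toMonoidHom ≤ T.DY := by
    unfold DY
    rw [MonoidHom.map_closure, Subgroup.closure_le]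
    rintro _ ⟨d, hd, rfl⟩
    change (TopOut.mk _ c)⁻¹ * d * ((TopOut.mk _ c)⁻¹)⁻¹ ∈ T.DY
    rw [inv_inv]
    exact h2 d hd
  refine le_antisymm ?_ fun d hd => ?_
  · unfold DY
    rw [MonoidHom.map_closure, Subgroup.closure_le]
    rintro _ ⟨d, hd, rfl⟩
    exact h1 d hd
  · have hd' : d = (MulAut.conj (TopOut.mk _ c)) ((MulAut.conj (TopOut.mk _ c)⁻¹) d) := by
      rw [← MulAut.mul_apply, ← map_mul, mul_inv_cancel, map_one, MulAut.one_apply]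
    rw [hd']
    exact ⟨_, hinv ⟨d, hd, rfl⟩, rfl⟩

/-! ## Automorphisms of shape `(a, g) ↦ (ψ a, γ g)` -/

section Shape

variable {T}
variable (c : contMulAut T.env) (γ : T.PiX ≃ₜ* T.PiX) (ψ : T.mu ≃* T.mu)

/-- The inverse of an automorphism of shape `(ψ, γ)` has shape `(ψ⁻¹, γ⁻¹)`.
[cite: MochizukiEtTh2009, Cor 2.18(iv) p.61] -/
theorem inv_shape
    (hl : ∀ x : T.env, ((c : MulAut T.env) x).left = ψ x.left)
    (hr : ∀ x : T.env, ((((c : MulAut T.env) x).right : T.PiY) : T.PiX) = γ (x.right : T.PiX)) :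
    (∀ x : T.env, (((c⁻¹ : contMulAut T.env) : MulAut T.env) x).left = ψ.symm x.left) ∧
    (∀ x : T.env, (((((c⁻¹ : contMulAut T.env) : MulAut T.env) x).right : T.PiY) : T.PiX) =
      γ.symm (x.right : T.PiX)) := by
  have hcc : ∀ x, (c : MulAut T.env) (((c⁻¹ : contMulAut T.env) : MulAut T.env) x) = x :=
    fun x => MulEquiv.apply_symm_apply _ x
  refine ⟨fun x => ?_, fun x => ?_⟩
  · have h := hl (((c⁻¹ : contMulAut T.env) : MulAut T.env) x)
    rw [hcc] at h
    rw [h, MulEquiv.symm_apply_apply]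
  · have h := hr (((c⁻¹ : contMulAut T.env) : MulAut T.env) x)
    rw [hcc] at h
    rw [h, ContinuousMulEquiv.symm_apply_apply]

/-- An automorphism of shape `(ψ, γ)`, with `γ⁻¹` respecting the fibres of the augmentation on
`Π^tp_Y` (`τ`) and `γ`, `ψ` respecting the cyclotomic character, conjugates the Kummer shift by
`δ ∘ aug` to the Kummer shift by `(ψ ∘ δ ∘ τ) ∘ aug`. [cite: MochizukiEtTh2009, Cor 2.18(iv) p.61] -/
theorem conj_shift_of_shape
    (hl : ∀ x : T.env, ((c : MulAut T.env) x).left = ψ x.left)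
    (hr : ∀ x : T.env, ((((c : MulAut T.env) x).right : T.PiY) : T.PiX) = γ (x.right : T.PiX))
    (hψ : ∀ (σ : T.G) (a : T.mu), ψ (T.chi σ a) = T.chi σ (ψ a))
    (hχ : ∀ x : T.PiX, T.chi (T.aug (γ x)) = T.chi (T.aug x))
    (τ : T.G → T.G) (hτ : ∀ g : T.PiY, T.aug (γ.symm (g : T.PiX)) = τ (T.augY g))
    {δ : T.G → T.mu} (hδ : CycEnvelope.IsEnvCocycle T.augY T.chi (δ ∘ T.augY)) :
    ∃ hδ' : CycEnvelope.IsEnvCocycle T.augY T.chi ((fun σ => ψ (δ (τ σ))) ∘ T.augY),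
      (c : MulAut T.env) * CycEnvelope.shift hδ * ((c⁻¹ : contMulAut T.env) : MulAut T.env) =
        CycEnvelope.shift hδ' := by
  obtain ⟨hl', hr'⟩ := inv_shape c γ ψ hl hr
  -- the function `g ↦ γ⁻¹ g` on `Π_Y`, realised through `c⁻¹`
  have hδval : ∀ g : T.PiY, δ (τ (T.augY g)) =
      δ (T.augY ((((c⁻¹ : contMulAut T.env) : MulAut T.env)
        (CycEnvelope.algSection T.augY T.chi g)).right)) := by
    intro g
    congr 1
    change τ (T.augY g) = T.aug (((((c⁻¹ : contMulAut T.env) : MulAut T.env)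
      (CycEnvelope.algSection T.augY T.chi g)).right : T.PiY) : T.PiX)
    rw [hr', SemidirectProduct.right_inr, hτ]
  have hδ' : CycEnvelope.IsEnvCocycle T.augY T.chi ((fun σ => ψ (δ (τ σ))) ∘ T.augY) := by
    intro g h
    simp only [Function.comp_apply]
    rw [hδval, hδval g, hδval h, map_mul, map_mul, SemidirectProduct.mul_right]
    have hc := hδ ((((c⁻¹ : contMulAut T.env) : MulAut T.env)
        (CycEnvelope.algSection T.augY T.chi g)).right)
      ((((c⁻¹ : contMulAut T.env) : MulAut T.env) (CycEnvelope.algSection T.augY T.chi h)).right)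
    simp only [Function.comp_apply] at hc
    rw [hc, map_mul, hψ]
    congr 2
    -- `χ(aug (γ⁻¹ g)) = χ(aug g)`
    change T.chi (T.aug ((((((c⁻¹ : contMulAut T.env) : MulAut T.env)
        (CycEnvelope.algSection T.augY T.chi g)).right : T.PiY) : T.PiX))) = T.chi (T.aug (g : T.PiX))
    rw [hr', SemidirectProduct.right_inr, ← hχ, ContinuousMulEquiv.apply_symm_apply]
  refine ⟨hδ', ?_⟩
  ext y
  · rw [MulAut.mul_apply, MulAut.mul_apply, hl, CycEnvelope.shift_apply, CycEnvelope.shift_apply]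
    simp only [map_mul, Function.comp_apply]
    rw [hl', MulEquiv.apply_symm_apply, hδval]
    have h1 : T.augY ((((c⁻¹ : contMulAut T.env) : MulAut T.env) y).right) =
        T.augY ((((c⁻¹ : contMulAut T.env) : MulAut T.env)
          (CycEnvelope.algSection T.augY T.chi y.right)).right) := by
      change T.aug (((((c⁻¹ : contMulAut T.env) : MulAut T.env) y).right : T.PiY) : T.PiX) =
        T.aug (((((c⁻¹ : contMulAut T.env) : MulAut T.env)
          (CycEnvelope.algSection T.augY T.chi y.right)).right : T.PiY) : T.PiX)
      rw [hr', hr', SemidirectProduct.right_inr]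
    rw [h1]
  · change ((((c : MulAut T.env) (CycEnvelope.shift hδ
        (((c⁻¹ : contMulAut T.env) : MulAut T.env) y))).right : T.PiY) : T.PiX) =
      (((CycEnvelope.shift hδ' y).right : T.PiY) : T.PiX)
    rw [hr]
    change γ ((((((c⁻¹ : contMulAut T.env) : MulAut T.env) y).right : T.PiY) : T.PiX)) =
      ((y.right : T.PiY) : T.PiX)
    rw [hr', ContinuousMulEquiv.apply_symm_apply]

/-- An automorphism of shape `(ψ, γ)` conjugates `conj_x` to `conj_{γ x}` (`γ`, `ψ` respecting the
cyclotomic character). [cite: MochizukiEtTh2009, Cor 2.18(iv) p.61] -/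
theorem conj_conjX_of_shape
    (hl : ∀ x : T.env, ((c : MulAut T.env) x).left = ψ x.left)
    (hr : ∀ x : T.env, ((((c : MulAut T.env) x).right : T.PiY) : T.PiX) = γ (x.right : T.PiX))
    (hψ : ∀ (σ : T.G) (a : T.mu), ψ (T.chi σ a) = T.chi σ (ψ a))
    (hχ : ∀ x : T.PiX, T.chi (T.aug (γ x)) = T.chi (T.aug x)) (x : T.PiX) :
    (c : MulAut T.env) * T.conjX x * ((c⁻¹ : contMulAut T.env) : MulAut T.env) = T.conjX (γ x) := by
  obtain ⟨hl', hr'⟩ := inv_shape c γ ψ hl hr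
  ext y
  · rw [MulAut.mul_apply, MulAut.mul_apply, hl]
    change ψ (T.chi (T.aug x) ((((c⁻¹ : contMulAut T.env) : MulAut T.env) y).left)) =
      T.chi (T.aug (γ x)) y.left
    rw [hl', hψ, MulEquiv.apply_symm_apply, hχ]
  · change ((((c : MulAut T.env) (T.conjX x (((c⁻¹ : contMulAut T.env) : MulAut T.env) y))).right
        : T.PiY) : T.PiX) = γ x * (y.right : T.PiX) * (γ x)⁻¹
    rw [hr]
    change γ (x * (((((c⁻¹ : contMulAut T.env) : MulAut T.env) y).right : T.PiY) : T.PiX) * x⁻¹) = _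
    rw [hr', map_mul, map_mul, map_inv, ContinuousMulEquiv.apply_symm_apply]

/-- An automorphism of shape `(ψ, γ)` as above conjugates every generator of `D_Y` into `D_Y`.
[cite: MochizukiEtTh2009, Cor 2.18(iv) p.61] -/
theorem DY_conj_gen_of_shape
    (hl : ∀ x : T.env, ((c : MulAut T.env) x).left = ψ x.left)
    (hr : ∀ x : T.env, ((((c : MulAut T.env) x).right : T.PiY) : T.PiX) = γ (x.right : T.PiX))
    (hψ : ∀ (σ : T.G) (a : T.mu), ψ (T.chi σ a) = T.chi σ (ψ a))
    (hχ : ∀ x : T.PiX, T.chi (T.aug (γ x)) = T.chi (T.aug x))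
    (τ : T.G → T.G) (hτ : ∀ g : T.PiY, T.aug (γ.symm (g : T.PiX)) = τ (T.augY g)) :
    ∀ d ∈ T.kummerOut ∪ T.galOut, TopOut.mk _ c * d * (TopOut.mk _ c)⁻¹ ∈ T.DY := by
  rintro d (⟨δ, hδ, hcδ, rfl⟩ | ⟨x, hcx, rfl⟩)
  · obtain ⟨hδ', heq⟩ := conj_shift_of_shape c γ ψ hl hr hψ hχ τ hτ hδ
    have hc' : CycEnvelope.shift hδ' ∈ contMulAut T.env := by
      rw [← heq]
      exact (c * ⟨_, hcδ⟩ * c⁻¹).2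
    rw [← map_mul, ← map_inv, ← map_mul]
    have he : c * ⟨_, hcδ⟩ * c⁻¹ = (⟨_, hc'⟩ : contMulAut T.env) := Subtype.ext heq
    rw [he]
    exact Subgroup.subset_closure (Or.inl ⟨_, hδ', hc', rfl⟩)
  · have heq := conj_conjX_of_shape c γ ψ hl hr hψ hχ x
    rw [← map_mul, ← map_inv, ← map_mul]
    have he : c * ⟨_, hcx⟩ * c⁻¹ = (⟨_, T.conjX_mem_contMulAut (γ x)⟩ : contMulAut T.env) :=
      Subtype.ext heq
    rw [he]
    exact Subgroup.subset_closure (Or.inr ⟨γ x, T.conjX_mem_contMulAut (γ x), rfl⟩)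

end Shape

end ThetaEnvData

end Literature.AnabelianGeometry.EtaleTheta
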